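import Mathlib.Combinatorics.SimpleGraph.Connectivity.Connected
import Mathlib.Data.Set.Card
import Literature.Probability.Percolation.PercolationEvents
import Literature.Probability.Percolation.Crossings
import HarnessLib

/-!
# Route PercTreeValue — `EquilateralAntiFactorisation` (item stmt-CriticalPhenomena-7800),
line `Sketch`, stub `stub_halfsum`: the pointwise "two-of-three" pivotal identity

For the restricted connection events `A = {x ↔ y in S}`, `B = {x ↔ z in S}`, `C = {y ↔ z in S}`
and `T = A ∩ B`, on the event `T` every `T`-pivotal pair `e` is pivotal for exactly two of the
three pair events `A, B, C`, and conversely; hence, for every set `K` of pairs,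
`2 · #(piv T ∩ K) = #(piv A ∩ K) + #(piv B ∩ K) + #(piv C ∩ K)` in `ℕ∞`.

Proof. All four events are increasing (`isUpperSet_openConnIn`), so for `ω` in the event a pair
`i` is pivotal iff `ω \ {i}` leaves the event. Writing `P, Q, R` for "`ω \ {i}` lies in
`A, B, C`", reachability inside `S` is an equivalence relation, which gives `P ∧ Q → R`,
`P ∧ R → Q`, `Q ∧ R → P`; the one graph-theoretic input is `¬P ∧ ¬Q → R`: deleting ONE edge from
a graph in which `x ∼ y` and `x ∼ z` separates `x` from at most one further class, so if both
`y` and `z` are cut off from `x` they lie in the same class (`Halfsum.reachable_or_of_adj`, an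
induction on a walk). Consequently `piv T = piv A ∪ piv B` and `piv C = piv A ∆ piv B` on `T`,
and the identity is `|a| + |b| = |a ∪ b| + |a ∩ b|`, `|a ∪ b \ a ∩ b| + |a ∩ b| = |a ∪ b|`
(`Set.encard_union_add_encard_inter`, `Set.encard_sdiff_add_encard_of_subset`).

References: G. Grimmett, *Percolation*, 2nd ed. (1999), §2.4 (pivotal edges, Russo's formula).
All helper lemmas live in the sub-namespace `Halfsum`.
-/

namespace Summit.CriticalPhenomena.PercolationContinuityZ3.Theorems.EquilateralAntiFactorisation

open Literature.Probability.Percolation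

namespace Halfsum

/-- One-edge perturbation of reachability. If every edge of `G` is an edge of `H` or the pair
`{a, b}`, then `G`-reachability `u ∼ v` gives `H`-reachability `u ∼ v`, or `u ∼ a` and `b ∼ v`
in `H`, or `u ∼ b` and `a ∼ v` in `H` (induction along a `G`-walk). [folklore] -/
theorem reachable_or_of_adj {W : Type*} {G H : SimpleGraph W} {a b : W}
    (hGH : ∀ p q, G.Adj p q → H.Adj p q ∨ (p = a ∧ q = b) ∨ (p = b ∧ q = a)) {u v : W}
    (huv : G.Reachable u v) :
    H.Reachable u v ∨ (H.Reachable u a ∧ H.Reachable b v) ∨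
      (H.Reachable u b ∧ H.Reachable a v) := by
  obtain ⟨w⟩ := huv
  induction w with
  | nil => exact Or.inl (SimpleGraph.Reachable.refl _)
  | @cons p q r hpq _ ih =>
    rcases hGH p q hpq with hH | ⟨rfl, rfl⟩ | ⟨rfl, rfl⟩
    · have hpq' : H.Reachable p q := hH.reachable
      rcases ih with h | ⟨h₁, h₂⟩ | ⟨h₁, h₂⟩
      · exact Or.inl (hpq'.trans h)
      · exact Or.inr (Or.inl ⟨hpq'.trans h₁, h₂⟩)
      · exact Or.inr (Or.inr ⟨hpq'.trans h₁, h₂⟩)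
    · rcases ih with h | ⟨_, h₂⟩ | ⟨_, h₂⟩
      · exact Or.inr (Or.inl ⟨SimpleGraph.Reachable.refl _, h⟩)
      · exact Or.inr (Or.inl ⟨SimpleGraph.Reachable.refl _, h₂⟩)
      · exact Or.inl h₂
    · rcases ih with h | ⟨_, h₂⟩ | ⟨_, h₂⟩
      · exact Or.inr (Or.inr ⟨SimpleGraph.Reachable.refl _, h⟩)
      · exact Or.inl h₂
      · exact Or.inr (Or.inr ⟨SimpleGraph.Reachable.refl _, h₂⟩)

/-- Two-of-three for a one-edge deletion. If every edge of `G` is an edge of `H` or the pair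
`{a, b}`, `x ∼ y` and `x ∼ z` in `G`, but neither `x ∼ y` nor `x ∼ z` in `H`, then `y ∼ z` in
`H`: removing one edge splits a class into at most two classes. [folklore] -/
theorem reachable_of_not_reachable₂ {W : Type*} {G H : SimpleGraph W} {a b : W}
    (hGH : ∀ p q, G.Adj p q → H.Adj p q ∨ (p = a ∧ q = b) ∨ (p = b ∧ q = a)) {x y z : W}
    (hxy : G.Reachable x y) (hxz : G.Reachable x z) (hxy' : ¬H.Reachable x y)
    (hxz' : ¬H.Reachable x z) : H.Reachable y z := by
  rcases reachable_or_of_adj hGH hxy with h | ⟨h₁, h₂⟩ | ⟨h₁, h₂⟩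
  · exact absurd h hxy'
  · rcases reachable_or_of_adj hGH hxz with h' | ⟨_, h₂'⟩ | ⟨h₁', h₂'⟩
    · exact absurd h' hxz'
    · exact h₂.symm.trans h₂'
    · exact h₂.symm.trans (h₁'.symm.trans (h₁.trans h₂'))
  · rcases reachable_or_of_adj hGH hxz with h' | ⟨h₁', h₂'⟩ | ⟨_, h₂'⟩
    · exact absurd h' hxz'
    · exact h₂.symm.trans (h₁'.symm.trans (h₁.trans h₂'))
    · exact h₂.symm.trans h₂'

/-- Two-of-three for closing one pair of a bond configuration, inside `S`: if `x ∼ y` and `x ∼ z`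
by open paths in `S` for `ω`, and closing the pair `i` destroys both connections, then `y ∼ z` by
an open path in `S` for `ω \ {i}`. (If `i` is a diagonal, or has an endpoint outside `S`, the
open graphs induced on `S` coincide and the hypotheses are contradictory.) [folklore] -/
theorem reachable_sdiff_singleton {V : Type*} (S : Set V) (ω : BondConfig V) (i : Sym2 V)
    {x y z : S} (hxy : ((openGraph ω).induce S).Reachable x y)
    (hxz : ((openGraph ω).induce S).Reachable x z)
    (hxy' : ¬((openGraph (ω \ {i})).induce S).Reachable x y)
    (hxz' : ¬((openGraph (ω \ {i})).induce S).Reachable x z) :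
    ((openGraph (ω \ {i})).induce S).Reachable y z := by
  induction i using Sym2.ind with
  | h a b =>
    have hAdj : ∀ p q : S, ((openGraph ω).induce S).Adj p q →
        ((openGraph (ω \ {s(a, b)})).induce S).Adj p q ∨
          ((p : V) = a ∧ (q : V) = b) ∨ ((p : V) = b ∧ (q : V) = a) := by
      intro p q hpq
      simp only [SimpleGraph.induce_adj, openGraph_adj, Set.mem_sdiff, Set.mem_singleton_iff,
        Sym2.eq_iff] at hpq ⊢
      tauto
    by_cases hab : a ∈ S ∧ b ∈ S
    · refine reachable_of_not_reachable₂ (a := (⟨a, hab.1⟩ : S)) (b := (⟨b, hab.2⟩ : S))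
        (fun p q hpq => ?_) hxy hxz hxy' hxz'
      rcases hAdj p q hpq with h | ⟨hp, hq⟩ | ⟨hp, hq⟩
      · exact Or.inl h
      · exact Or.inr (Or.inl ⟨Subtype.ext hp, Subtype.ext hq⟩)
      · exact Or.inr (Or.inr ⟨Subtype.ext hp, Subtype.ext hq⟩)
    · refine absurd (hxy.mono fun p q hpq => ?_) hxy'
      rcases hAdj p q hpq with h | ⟨hp, hq⟩ | ⟨hp, hq⟩
      · exact h
      · exact (hab ⟨hp ▸ p.2, hq ▸ q.2⟩).elim
      · exact (hab ⟨hq ▸ q.2, hp ▸ p.2⟩).elim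

/-- For an increasing event `A` and a configuration `ω ∈ A`, the coordinate `i` is pivotal iff
closing it leaves the event: `ω ∪ {i} ∈ A` automatically. (Grimmett 1999, §2.4.) [folklore] -/
theorem isPivotal_iff_sdiff_notMem {ι : Type*} {A : Set (Set ι)} (hA : IsUpperSet A)
    {ω : Set ι} (hω : ω ∈ A) (i : ι) : IsPivotal A i ω ↔ ω \ {i} ∉ A := by
  have h1 : insert i ω ∈ A := hA (Set.subset_insert i ω) hω
  unfold IsPivotal Xor
  tauto

/-- Membership in `{x ↔ y in S}` for `x, y ∈ S` is reachability in the open graph induced on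
`S`. (Grimmett 1999, §1.3.) [folklore] -/
theorem mem_openConnIn_iff_reachable {V : Type*} {S : Set V} {x y : V} (hx : x ∈ S)
    (hy : y ∈ S) (ω : BondConfig V) :
    ω ∈ openConnIn S x y ↔ ((openGraph ω).induce S).Reachable ⟨x, hx⟩ ⟨y, hy⟩ :=
  ⟨fun ⟨_, _, h⟩ => h, fun h => ⟨hx, hy, h⟩⟩

/-- Propositional core of two-of-three: if `P, Q, R` ("the pair connection survives") satisfy
the three transitivity implications and `¬P ∧ ¬Q → R`, then `¬(P ∧ Q) ↔ ¬P ∨ ¬Q` and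
`¬R ↔ (¬P ∨ ¬Q) ∧ ¬(¬P ∧ ¬Q)`. [folklore] -/
theorem two_of_three_logic {P Q R : Prop} (h₁ : ¬P → ¬Q → R) (h₂ : P → Q → R) (h₃ : P → R → Q)
    (h₄ : Q → R → P) :
    (¬(P ∧ Q) ↔ (¬P ∨ ¬Q)) ∧ (¬R ↔ ((¬P ∨ ¬Q) ∧ ¬(¬P ∧ ¬Q))) := by
  tauto

/-- The cardinal identity behind two-of-three: `2 |a ∪ b| = |a| + |b| + |a ∆ b|` in `ℕ∞`, with
the symmetric difference written as `(a ∪ b) \ (a ∩ b)`. [folklore] -/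
theorem two_mul_encard_union {α : Type*} (a b : Set α) :
    2 * (a ∪ b).encard = a.encard + b.encard + ((a ∪ b) \ (a ∩ b)).encard := by
  rw [two_mul, ← Set.encard_union_add_encard_inter a b, add_assoc, add_comm (a ∩ b).encard,
    Set.encard_sdiff_add_encard_of_subset (Set.inter_subset_left.trans Set.subset_union_left)]

end Halfsum

/-- **S1 (two-of-three, pointwise).** On the event `T = {x ↔ y in S} ∩ {x ↔ z in S}`, a pair is
pivotal for `T` iff it is pivotal for `{x ↔ y in S}` or for `{x ↔ z in S}`, and it is pivotal
for `{y ↔ z in S}` iff it is pivotal for exactly one of these two; hence for every set of pairs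
`K`, `2 · #(piv T ∩ K) = #(piv{x↔y} ∩ K) + #(piv{x↔z} ∩ K) + #(piv{y↔z} ∩ K)` in `ℕ∞`.
(Grimmett 1999, §2.4, pivotal edges.) [folklore] -/
theorem stub_halfsum {V : Type*} (S : Set V) (x y z : V) (K : Set (Sym2 V)) (ω : BondConfig V)
    (h : ω ∈ openConnIn S x y ∩ openConnIn S x z) :
    2 * (pivotals (openConnIn S x y ∩ openConnIn S x z) ω ∩ K).encard =
      (pivotals (openConnIn S x y) ω ∩ K).encard + (pivotals (openConnIn S x z) ω ∩ K).encard +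
        (pivotals (openConnIn S y z) ω ∩ K).encard := by
  obtain ⟨⟨hx, hy, hxy⟩, ⟨_, hz, hxz⟩⟩ := h
  have hωA : ω ∈ openConnIn S x y := ⟨hx, hy, hxy⟩
  have hωB : ω ∈ openConnIn S x z := ⟨hx, hz, hxz⟩
  have hωC : ω ∈ openConnIn S y z := ⟨hy, hz, hxy.symm.trans hxz⟩
  have key : ∀ i : Sym2 V,
      (IsPivotal (openConnIn S x y ∩ openConnIn S x z) i ω ↔
          (IsPivotal (openConnIn S x y) i ω ∨ IsPivotal (openConnIn S x z) i ω)) ∧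
        (IsPivotal (openConnIn S y z) i ω ↔
          ((IsPivotal (openConnIn S x y) i ω ∨ IsPivotal (openConnIn S x z) i ω) ∧
            ¬(IsPivotal (openConnIn S x y) i ω ∧ IsPivotal (openConnIn S x z) i ω))) := by
    intro i
    rw [Halfsum.isPivotal_iff_sdiff_notMem
        ((isUpperSet_openConnIn S x y).inter (isUpperSet_openConnIn S x z)) ⟨hωA, hωB⟩ i,
      Halfsum.isPivotal_iff_sdiff_notMem (isUpperSet_openConnIn S x y) hωA i,
      Halfsum.isPivotal_iff_sdiff_notMem (isUpperSet_openConnIn S x z) hωB i,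
      Halfsum.isPivotal_iff_sdiff_notMem (isUpperSet_openConnIn S y z) hωC i, Set.mem_inter_iff,
      Halfsum.mem_openConnIn_iff_reachable hx hy (ω \ {i}),
      Halfsum.mem_openConnIn_iff_reachable hx hz (ω \ {i}),
      Halfsum.mem_openConnIn_iff_reachable hy hz (ω \ {i})]
    exact Halfsum.two_of_three_logic
      (fun h h' => Halfsum.reachable_sdiff_singleton S ω i hxy hxz h h')
      (fun h h' => h.symm.trans h') (fun h h' => h.trans h') (fun h h' => h.trans h'.symm)
  have hT : pivotals (openConnIn S x y ∩ openConnIn S x z) ω ∩ K =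
      (pivotals (openConnIn S x y) ω ∩ K) ∪ (pivotals (openConnIn S x z) ω ∩ K) := by
    ext i
    obtain ⟨k, -⟩ := key i
    simp only [Set.mem_inter_iff, Set.mem_union, mem_pivotals]
    tauto
  have hC : pivotals (openConnIn S y z) ω ∩ K =
      ((pivotals (openConnIn S x y) ω ∩ K) ∪ (pivotals (openConnIn S x z) ω ∩ K)) \
        ((pivotals (openConnIn S x y) ω ∩ K) ∩ (pivotals (openConnIn S x z) ω ∩ K)) := by
    ext i
    obtain ⟨-, k⟩ := key i
    simp only [Set.mem_inter_iff, Set.mem_union, Set.mem_sdiff, mem_pivotals]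
    tauto
  rw [hT, hC]
  exact Halfsum.two_mul_encard_union _ _

end Summit.CriticalPhenomena.PercolationContinuityZ3.Theorems.EquilateralAntiFactorisation
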